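import Literature.AlgebraicGeometry.Modules.LocallyFreeSectionsTorsionFree
import Literature.AlgebraicGeometry.Motives.HodgeSheavesProofs
import Literature.AlgebraicGeometry.Motives.CrystallineRealization
import Mathlib.AlgebraicGeometry.Morphisms.Smooth
import HarnessLib

/-!
# The Hodge sheaves `Ωᵃ_{𝒳/W}` of a smooth `W(k)`-scheme have no `p`-torsion

For `k` a field of characteristic `p` and `𝒳` a `W(k)`-scheme SMOOTH of relative dimension `d`
(`SmoothOfRelativeDimension d 𝒳.hom`, e.g. `WittScheme.IsSmoothProperModel d 𝒳`), the Hodge sheaves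
`hodgeSheaf 𝒳 a = Ωᵃ_{𝒳/W}` (`Motives/HodgeSheaves`; `a = 0`: `𝒪_𝒳`, `a = 1`: `Ω¹_{𝒳/W} = cotangentSheaf`)
are finite locally free (`isFiniteLocallyFree_hodgeSheaf`, from the tree's discharged fact
`hasRank_hodgeSheaf_choose_holds`; `isFiniteLocallyFree_cotangentSheaf`), `𝒳` is flat over `W(k)`
(smooth ⇒ flat, Mathlib), and `p` is regular in the domain `W(k)`; hence
(`Modules/FlatSectionsRegular`, `Modules/LocallyFreeSectionsTorsionFree`):

* `mono_p_smul_id_hodgeSheaf`, `mono_p_smul_id_cotangentSheaf`, `mono_p_smul_id_structureSheaf` —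
  multiplication by `p` is a MONOMORPHISM of the abelian sheaves underlying `Ωᵃ_{𝒳/W}`, `Ω¹_{𝒳/W}`,
  `𝒪_𝒳` (the sheaves whose `Sheaf.H` are `hodgeCohomology 𝒳 a b`, `hodgeCohomologyOne 𝒳 b`,
  `structureSheafCohomology 𝒳.left b`);
* `eq_zero_of_p_smul_eq_zero_hodgeSheaf` (& `…_cotangentSheaf`, `…_structureSheaf`) — no group of
  sections `Γ(Ωᵃ, U)`, `Γ(Ω¹, U)`, `Γ(𝒳, U)` has `p`-torsion;
* the `IsSmoothProperModel` wrappers `IsSmoothProperModel.mono_p_smul_id_hodgeSheaf` etc.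

This is the standing hypothesis "`Ωʲ_𝒳` is `p`-torsion free" of X. Hu, arXiv:2507.12458, Def. 8.2
(term identification `p^{(r-j)M} Ωʲ_{X_{(r-j)N}} ≅ Ωʲ_{X_{(r-j)(N-M)}}`: `Algebra/Homology/StaircaseTorsionFree`,
hypothesis `Mono ((q : ℤ) • 𝟙 T)`) and of Bloch–Esnault–Kerz 2014, §8 (`𝒪_{X_n} = 𝒪_𝒳/pⁿ`,
Bockstein package `Algebra/Homology/ExtCokernelBockstein`, hypothesis `hq : Mono (q • 𝟙 F)`).
Everything is proved; no named facts (the inputs `hasRank_hodgeSheaf_choose`,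
`isLocallyFree_cotangentSheaf` are discharged facts of the tree).
-/

noncomputable section

namespace Literature.AlgebraicGeometry.Crystalline

open CategoryTheory CategoryTheory.Limits _root_.AlgebraicGeometry Opposite TopologicalSpace
open Literature.AlgebraicGeometry.Motives Literature.AlgebraicGeometry.Modules

universe u

/-! ## 1. Hodge sheaves of a smooth scheme are finite locally free -/

section Smooth

variable {K : Type u} [CommRing K] (X : SchemeOver K) (d : ℕ) [SmoothOfRelativeDimension d X.hom]

include d

/-- For `X → Spec K` smooth of relative dimension `d`, `Ωᵃ_{X/K} = hodgeSheaf X a` is finite locally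
free (of rank `d.choose a`: the tree's discharged fact `hasRank_hodgeSheaf_choose_holds`).
[cite: Hartshorne1977, II Ex. 5.16(a) and II Thm. 8.15] -/
theorem isFiniteLocallyFree_hodgeSheaf (a : ℕ) : IsFiniteLocallyFree (hodgeSheaf X a) := by
  obtain ⟨q, hq, hfin⟩ := hasRank_hodgeSheaf_choose_holds X d a
  exact (HasRank.hasRankLE ⟨q, hq, hfin⟩).isFiniteLocallyFree

/-- For `X → Spec K` smooth of relative dimension `d`, `Ω¹_{X/K} = cotangentSheaf X` is finite
locally free (via `hodgeSheafOneIso : Ω¹ ≅ ⋀¹ Ω¹`). [cite: StacksProject, Tag 02G1] -/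
theorem isFiniteLocallyFree_cotangentSheaf : IsFiniteLocallyFree (cotangentSheaf X) := by
  intro x
  obtain ⟨U, hxU, I, hI, ⟨i⟩⟩ := isFiniteLocallyFree_hodgeSheaf X d 1 x
  exact ⟨U, hxU, I, hI, ⟨i ≪≫ (Scheme.Modules.overFunctor U).mapIso (hodgeSheafOneIso X)⟩⟩

end Smooth

/-! ## 2. Smooth `W(k)`-schemes: no `p`-torsion -/

section Witt

variable {p : ℕ} [Fact p.Prime] {k : Type u} [Field k] [CharP k p]
  (𝒳 : SchemeOver (WittVector p k)) (d : ℕ) [SmoothOfRelativeDimension d 𝒳.hom]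

include d

omit [CharP k p] in
/-- A smooth `W(k)`-scheme is flat over `W(k)` (smooth ⇒ flat, Mathlib). [folklore] -/
theorem flat_hom_of_smoothOfRelativeDimension : Flat 𝒳.hom := by
  haveI : Smooth 𝒳.hom := SmoothOfRelativeDimension.smooth d 𝒳.hom
  infer_instance

/-- **`p • 𝟙 Ωᵃ_{𝒳/W}` is mono** for `𝒳/W(k)` smooth: the abelian sheaf underlying
`hodgeSheaf 𝒳 a` (whose `Sheaf.H` is `hodgeCohomology 𝒳 a b`) has no `p`-torsion
("`Ωʲ_𝒳` is `p`-torsion free", X. Hu, arXiv:2507.12458, Def. 8.2). [cite: StacksProject, Tag 01C6] -/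
theorem mono_p_smul_id_hodgeSheaf (a : ℕ) :
    Mono ((p : ℤ) • 𝟙 ((SheafOfModules.toSheaf 𝒳.left.ringCatSheaf).obj (hodgeSheaf 𝒳 a))) := by
  haveI := flat_hom_of_smoothOfRelativeDimension 𝒳 d
  exact mono_p_smul_id_toSheaf_of_flat_witt 𝒳.hom (isFiniteLocallyFree_hodgeSheaf 𝒳 d a)

/-- **`p • 𝟙 Ω¹_{𝒳/W}` is mono** for `𝒳/W(k)` smooth: the abelian sheaf underlying
`cotangentSheaf 𝒳` (whose `Sheaf.H` is `hodgeCohomologyOne 𝒳 b`) has no `p`-torsion.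
[cite: StacksProject, Tag 01C6] -/
theorem mono_p_smul_id_cotangentSheaf :
    Mono ((p : ℤ) • 𝟙 ((SheafOfModules.toSheaf 𝒳.left.ringCatSheaf).obj (cotangentSheaf 𝒳))) := by
  haveI := flat_hom_of_smoothOfRelativeDimension 𝒳 d
  exact mono_p_smul_id_toSheaf_of_flat_witt 𝒳.hom (isFiniteLocallyFree_cotangentSheaf 𝒳 d)

/-- **`p • 𝟙 𝒪_𝒳` is mono** for `𝒳/W(k)` smooth: the abelian sheaf underlying the structure sheaf
(whose `Sheaf.H` is `structureSheafCohomology 𝒳.left b`) has no `p`-torsion.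
[cite: StacksProject, Tag 00HI] -/
theorem mono_p_smul_id_structureSheaf :
    Mono ((p : ℤ) • 𝟙 ((SheafOfModules.toSheaf 𝒳.left.ringCatSheaf).obj
      (SheafOfModules.unit 𝒳.left.ringCatSheaf))) := by
  haveI := flat_hom_of_smoothOfRelativeDimension 𝒳 d
  exact mono_p_smul_id_structureSheaf_of_flat_witt 𝒳.hom

/-- No `Γ(Ωᵃ_{𝒳/W}, U)` has `p`-torsion, for `𝒳/W(k)` smooth. [cite: StacksProject, Tag 01C6] -/
theorem eq_zero_of_p_smul_eq_zero_hodgeSheaf (a : ℕ) (U : 𝒳.left.Opens)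
    (s : Γ(hodgeSheaf 𝒳 a, U)) (hs : (p : ℤ) • s = 0) : s = 0 := by
  haveI := flat_hom_of_smoothOfRelativeDimension 𝒳 d
  exact eq_zero_of_p_smul_eq_zero_of_isFiniteLocallyFree_of_flat_witt 𝒳.hom
    (isFiniteLocallyFree_hodgeSheaf 𝒳 d a) U s hs

/-- No `Γ(Ω¹_{𝒳/W}, U)` has `p`-torsion, for `𝒳/W(k)` smooth. [cite: StacksProject, Tag 01C6] -/
theorem eq_zero_of_p_smul_eq_zero_cotangentSheaf (U : 𝒳.left.Opens)
    (s : Γ(cotangentSheaf 𝒳, U)) (hs : (p : ℤ) • s = 0) : s = 0 := by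
  haveI := flat_hom_of_smoothOfRelativeDimension 𝒳 d
  exact eq_zero_of_p_smul_eq_zero_of_isFiniteLocallyFree_of_flat_witt 𝒳.hom
    (isFiniteLocallyFree_cotangentSheaf 𝒳 d) U s hs

/-- No `Γ(𝒳, U)` has `p`-torsion, for `𝒳/W(k)` smooth. [cite: StacksProject, Tag 00HI] -/
theorem eq_zero_of_p_smul_eq_zero_structureSheaf (U : 𝒳.left.Opens) (s : Γ(𝒳.left, U))
    (hs : (p : ℤ) • s = 0) : s = 0 := by
  haveI := flat_hom_of_smoothOfRelativeDimension 𝒳 d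
  exact eq_zero_of_p_smul_eq_zero_of_flat_witt 𝒳.hom U s hs

end Witt

/-! ## 3. Wrappers for `WittScheme.IsSmoothProperModel` -/

section Model

variable {p : ℕ} [Fact p.Prime] {k : Type u} [Field k] [CharP k p]
  {𝒳 : SchemeOver (WittVector p k)} {d : ℕ}

/-- For a smooth proper model `𝒳/W(k)` (`IsSmoothProperModel`, the hypothesis of the `p`-adic
deformation statements of the tree), `p • 𝟙 Ωᵃ_{𝒳/W}` is mono for every `a`.
[cite: StacksProject, Tag 01C6] -/
theorem _root_.Literature.AlgebraicGeometry.Motives.WittScheme.IsSmoothProperModel.mono_p_smul_id_hodgeSheaf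
    (h𝒳 : WittScheme.IsSmoothProperModel d 𝒳) (a : ℕ) :
    Mono ((p : ℤ) • 𝟙 ((SheafOfModules.toSheaf 𝒳.left.ringCatSheaf).obj (hodgeSheaf 𝒳 a))) := by
  haveI := h𝒳.smoothOfRelativeDimension
  exact Literature.AlgebraicGeometry.Crystalline.mono_p_smul_id_hodgeSheaf 𝒳 d a

/-- For a smooth proper model `𝒳/W(k)`, `p • 𝟙 Ω¹_{𝒳/W}` is mono. [cite: StacksProject, Tag 01C6] -/
theorem _root_.Literature.AlgebraicGeometry.Motives.WittScheme.IsSmoothProperModel.mono_p_smul_id_cotangentSheaf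
    (h𝒳 : WittScheme.IsSmoothProperModel d 𝒳) :
    Mono ((p : ℤ) • 𝟙 ((SheafOfModules.toSheaf 𝒳.left.ringCatSheaf).obj (cotangentSheaf 𝒳))) := by
  haveI := h𝒳.smoothOfRelativeDimension
  exact Literature.AlgebraicGeometry.Crystalline.mono_p_smul_id_cotangentSheaf 𝒳 d

/-- For a smooth proper model `𝒳/W(k)`, `p • 𝟙 𝒪_𝒳` is mono. [cite: StacksProject, Tag 00HI] -/
theorem _root_.Literature.AlgebraicGeometry.Motives.WittScheme.IsSmoothProperModel.mono_p_smul_id_structureSheaf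
    (h𝒳 : WittScheme.IsSmoothProperModel d 𝒳) :
    Mono ((p : ℤ) • 𝟙 ((SheafOfModules.toSheaf 𝒳.left.ringCatSheaf).obj
      (SheafOfModules.unit 𝒳.left.ringCatSheaf))) := by
  haveI := h𝒳.smoothOfRelativeDimension
  exact Literature.AlgebraicGeometry.Crystalline.mono_p_smul_id_structureSheaf 𝒳 d

end Model

end Literature.AlgebraicGeometry.Crystalline
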